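import Literature.MathematicalPhysics.QuantumFieldTheory.Balaban1983to89.B9Thm31CubeLocalFlat
import Literature.MathematicalPhysics.QuantumFieldTheory.Balaban1983to89.B9CubeCoarseningGlobal
import Literature.MathematicalPhysics.QuantumFieldTheory.Balaban1983to89.B8Ineq198MultiLevelTorusL0

/-!
# `Balaban1983to89.B9Thm31CubeLocalFlatMemberGlobal` — [B9] THEOREM 3.1 (3.42) AT `U = 1` FOR THE CUBE-LOCAL LETTER `G′_□` IN THE MEMBER'S
# CURRENCY, GLOBAL FORM: the four sup entries of `G′_□(1) = GpCubeW` (weights `wCube`) as POINTWISE BOUNDS OVER THE MEMBER'S BLOCKS, LEVELS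
# AND (2.46) DISTANCE for sources in ANY member block — file 2 v1.1 §6 carried through file 1c's `majorant_transfer_global` and [4] Lemma 2.1
# (2.61) for the cube sequence (`B8Ineq198MultiLevelTorusL0.rowSum_and_thresholdT`)  (sub-row G-B9-LETTERS, module M5.1a, file 2e)

FRAMING (verbatim cell line):
statement-level skeleton of published theorems with citation tags; proofs where landed; nothing here is a claim about the Yang–Mills mass gap

Sources under audit (cell lit-balaban): T. Bałaban, *Propagators for lattice gauge theories in a background field*, Commun. Math. Phys. **99**
(1985) 389–434 [`Balaban1985BackgroundPropagators`, "B9"], Thm 3.1 (3.42) p. 397, Cor. 3.5 p. 407, p. 409 l. 1–5; T. Bałaban, *Propagators and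
renormalization transformations for lattice gauge theories. II*, Commun. Math. Phys. **96** (1984) 223–250 [`Balaban1984PropagatorsII`, "[4]"],
Prop. 2.2 (2.67) p. 234, (2.46) p. 231, (2.51) p. 232, Lemma 2.1 (2.59)–(2.61) pp. 233–234.  Unit `lit-balaban-r05` (r05 gen 77).

## WHAT IS PRINTED (verbatim up to notation)

[B9] (3.42) p. 397: «|(G′(U)λ)(x)|, |(∇_UG′(U)λ)(x)|, |(G′(U)∇*_Uλ)(x)|, |(Δ_UG′(U)λ)(x)| ≦ B₀[(L^jη)², L^jη, L^jη, 1]e^{−δ₀d(y,y′)}|λ| for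
x ∈ Δ(y), y ∈ Λ_j, supp λ ⊂ Δ(y′)»; p. 409 l. 1–5: the cube letters «satisfy all the inequalities of Theorems 3.1–3.3».  [4] (2.61) p. 234:
«sup_{y∈𝔅} Σ_{y′∈𝔅} e^{−αδ₀d(y,y′)} ≤ c₁(α)».

## WHAT THIS FILE CERTIFIES (kernel-checked; lattice units; `F := cubeFam D q …`, `G′_□ := GpCubeW D q …`)

**`thm31_cubeW_member_global`**: there are `δ₀, C, M₀ > 0`, `N₀ ≥ 1` (functions of `d, L` only) such that for every member `D` (odd `L ≥ 2`,
odd `M_h ≥ 3`, `L·M_h ≥ M₀`, `R ≥ 2L`, `R·L·M_h ≥ N₀ + 1`, `P ≥ 4`), every cover cube `q`, EVERY member block `y′`, every `λ` with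
`supp λ ⊂ y′`, `|λ| ≤ B`, every torus point `x` (member block `y(x)`, member level `j = lev_D x`) and every axis `μ`:
`|(G′_□λ)(x)| ≤ C·L^{2j}·e^{−δ₀ d(y(x),y′)}·B`, `|(∂_μG′_□λ)(x)|, |(G′_□∂_μᵀλ)(x)| ≤ C·L^{j}·e^{−δ₀ d}·B`, `|((−Δ^{per})G′_□λ)(x)| ≤ C·e^{−δ₀ d}·B`
— `d` = the MEMBER's (2.46) distance; `δ₀` = a quarter of the cube majorants' merged rate.

## HONEST SCOPE

* `U = 1`; cube family of file 1 (single scale, mass-`a = a₀ = a₁ = 1` floor).  Constants are not computed beyond what the lineage gives.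
* Nothing is inferred from the manuscript; kernel-checked.  NOT summit progress; the YM mass gap is not proved by any of this.
-/

namespace Literature.MathematicalPhysics.QuantumFieldTheory.Balaban1983to89.B9Thm31CubeLocalFlatMemberGlobal

open Literature.MathematicalPhysics.QuantumFieldTheory.Balaban1983to89.B4Reflection242 (boxDom)
open Literature.MathematicalPhysics.QuantumFieldTheory.Balaban1983to89.B6MultiLevelBoxOperator (N0)
open Literature.MathematicalPhysics.QuantumFieldTheory.Balaban1983to89.B6MultiLevelTorusOperator (perLapT)
open Literature.MathematicalPhysics.QuantumFieldTheory.Balaban1983to89.B6Cover236MultiLevelBlocks (cubes)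
open Literature.MathematicalPhysics.QuantumFieldTheory.Balaban1983to89.B6Geom246MultiLevelBox (bset blkOf)
open Literature.MathematicalPhysics.QuantumFieldTheory.Balaban1983to89.B6Geom246MultiLevelTorus (geomT)
open Literature.MathematicalPhysics.QuantumFieldTheory.Balaban1983to89.B6Geom246MultiLevelTorusL0 (triangle_refl_nonneg_T)
open Literature.MathematicalPhysics.QuantumFieldTheory.Balaban1983to89.B6Ineq261LevelGap (K261 K261_nonneg)
open Literature.MathematicalPhysics.QuantumFieldTheory.Balaban1983to89.B6RandomWalk (HasMajorant BlockSupp hasMajorant_mono)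
open Literature.MathematicalPhysics.QuantumFieldTheory.Balaban1983to89.B6Prop22DerivMultiLevelTorus (dT)
open Literature.MathematicalPhysics.QuantumFieldTheory.Balaban1983to89.B8Ineq198MultiLevelTorusL0 (rowSum_and_thresholdT)
open Literature.MathematicalPhysics.QuantumFieldTheory.Balaban1983to89.B9CubeSequence408 (cubeFam)
open Literature.MathematicalPhysics.QuantumFieldTheory.Balaban1983to89.B9CubeCoarseningGlobal (majorant_transfer_global)
open Literature.MathematicalPhysics.QuantumFieldTheory.Balaban1983to89.B9Thm31CubeLocalFlat (GpCubeW thm31_cubeW_flat_first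
  thm31_cubeW_flat_second thm31_cubeW_flat_third thm31_cubeW_flat_sixth)
open scoped Matrix

variable {d : ℕ}

/-- **THEOREM 3.1 (3.42) AT `U = 1` FOR `G′_□`, ALL FOUR SUP ENTRIES, IN THE MEMBER'S BLOCKS AND DISTANCE, FOR SOURCES IN ANY MEMBER BLOCK**
(one set of constants for every member and every cube). [cite: Balaban1985BackgroundPropagators, Thm 3.1 (3.42) p.397 with Cor. 3.5 p.407 and p.409 l.1–5; Balaban1984PropagatorsII, Prop. 2.2 (2.67) p.234, (2.46) p.231, (2.51) p.232, Lemma 2.1 (2.61) p.234] -/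
theorem thm31_cubeW_member_global (d ℓ : ℕ) (hℓ : 1 ≤ ℓ) :
    ∃ δ₀ C M₀ : ℝ, ∃ N₀ : ℕ, 0 < δ₀ ∧ 0 < C ∧ 0 < M₀ ∧ 0 < N₀ ∧
      ∀ {Mh k R : ℕ} {P : Fin (d + 1) → ℕ} (D : B6MultiLevelTorusOperator.TDomains d ℓ Mh k P R)
        (q : ↥(cubes D.toDomains)) (hL : Odd (ℓ + 1)) (hM : Odd Mh) (hMh : 1 ≤ Mh) (hP : ∀ μ, 1 ≤ P μ),
        3 ≤ Mh → M₀ ≤ ((ℓ : ℝ) + 1) * Mh → 2 * (ℓ + 1) ≤ R → N₀ + 1 ≤ R * ((ℓ + 1) * Mh) → (∀ μ, 4 ≤ P μ) →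
        ∀ (y' : ↥(bset D.toDomains)) (lam : ↥(boxDom (N0 ℓ Mh k P)) → ℝ) (B : ℝ),
          BlockSupp (g := geomT D) (blkOf D.toDomains) lam y' B →
        ∀ x : ↥(boxDom (N0 ℓ Mh k P)),
          |(GpCubeW D q hL hM hMh hP *ᵥ lam) x| ≤
              C * ((ℓ : ℝ) + 1) ^ (2 * D.lev x.1) * Real.exp (-(δ₀ * (geomT D).dist (blkOf D.toDomains x) y')) * B ∧
          (∀ μ : Fin (d + 1), |((dT (N0 ℓ Mh k P) μ * GpCubeW D q hL hM hMh hP) *ᵥ lam) x| ≤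
              C * ((ℓ : ℝ) + 1) ^ D.lev x.1 * Real.exp (-(δ₀ * (geomT D).dist (blkOf D.toDomains x) y')) * B) ∧
          (∀ μ : Fin (d + 1), |((GpCubeW D q hL hM hMh hP * (dT (N0 ℓ Mh k P) μ).transpose) *ᵥ lam) x| ≤
              C * ((ℓ : ℝ) + 1) ^ D.lev x.1 * Real.exp (-(δ₀ * (geomT D).dist (blkOf D.toDomains x) y')) * B) ∧
          |((perLapT (N0 ℓ Mh k P) * GpCubeW D q hL hM hMh hP) *ᵥ lam) x| ≤
              C * Real.exp (-(δ₀ * (geomT D).dist (blkOf D.toDomains x) y')) * B := by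
  obtain ⟨δa, Ca, Ma, Na, hδa, hCa, hMa, hNa, hA⟩ := thm31_cubeW_flat_first d ℓ hℓ
  obtain ⟨δb, Cb, Mb, Nb, hδb, hCb, hMb, hNb, hB⟩ := thm31_cubeW_flat_second d ℓ hℓ
  obtain ⟨δc, Cc, Mc, Nc, hδc, hCc, hMc, hNc, hCC⟩ := thm31_cubeW_flat_third d ℓ hℓ
  obtain ⟨δe, Ce, Me, Ne, hδe, hCe, hMe, hNe, hE⟩ := thm31_cubeW_flat_sixth d ℓ hℓ
  -- merged rate and constant of the cube majorants; the (2.61) rate `σ = δ_m/4` and its threshold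
  set δm : ℝ := min (min δa δb) (min δc δe) with hδm
  set Cm : ℝ := max (max Ca Cb) (max Cc Ce) with hCm
  have hδm0 : 0 < δm := lt_min (lt_min hδa hδb) (lt_min hδc hδe)
  have hCm0 : 0 < Cm := lt_max_of_lt_left (lt_max_of_lt_left hCa)
  set σ : ℝ := δm / 4 with hσ
  have hσ0 : 0 < σ := by rw [hσ]; linarith
  set N₁ : ℕ := ⌈(2 * ((d : ℝ) + 1) + (0 : ℕ) + 1) * ((ℓ : ℝ) + 1) / σ⌉₊ + 1 with hN₁
  set K : ℝ := K261 N₁ (d + 1) ((ℓ : ℝ) + 1) 1 (1 * σ) with hK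
  have hK0 : 0 ≤ K := K261_nonneg (by positivity) zero_le_one
  refine ⟨σ, Cm * (K + 1), max (max Ma Mb) (max Mc Me), max (max (max Na Nb) (max Nc Ne)) N₁, hσ0, by positivity,
    lt_max_of_lt_left (lt_max_of_lt_left hMa), lt_max_of_lt_left (lt_max_of_lt_left (lt_max_of_lt_left hNa)), ?_⟩
  intro Mh k R P D q hL hM hMh hP h3 hM0 hR hN0 hP4 y' lam B hlam x
  have hL0 : (0 : ℝ) ≤ (ℓ : ℝ) + 1 := by positivity
  -- thresholds
  have hMa' : Ma ≤ ((ℓ : ℝ) + 1) * Mh := ((le_max_left _ _).trans (le_max_left _ _)).trans hM0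
  have hMb' : Mb ≤ ((ℓ : ℝ) + 1) * Mh := ((le_max_right _ _).trans (le_max_left _ _)).trans hM0
  have hMc' : Mc ≤ ((ℓ : ℝ) + 1) * Mh := ((le_max_left _ _).trans (le_max_right _ _)).trans hM0
  have hMe' : Me ≤ ((ℓ : ℝ) + 1) * Mh := ((le_max_right _ _).trans (le_max_right _ _)).trans hM0
  have hN0' : max (max Na Nb) (max Nc Ne) + 1 ≤ R * ((ℓ + 1) * Mh) := le_trans (Nat.succ_le_succ (le_max_left _ _)) hN0
  have hNa' : Na + 1 ≤ R * ((ℓ + 1) * Mh) := le_trans (Nat.succ_le_succ ((le_max_left _ _).trans (le_max_left _ _))) hN0'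
  have hNb' : Nb + 1 ≤ R * ((ℓ + 1) * Mh) := le_trans (Nat.succ_le_succ ((le_max_right _ _).trans (le_max_left _ _))) hN0'
  have hNc' : Nc + 1 ≤ R * ((ℓ + 1) * Mh) := le_trans (Nat.succ_le_succ ((le_max_left _ _).trans (le_max_right _ _))) hN0'
  have hNe' : Ne + 1 ≤ R * ((ℓ + 1) * Mh) := le_trans (Nat.succ_le_succ ((le_max_right _ _).trans (le_max_right _ _))) hN0'
  have hN1' : N₁ + 1 ≤ R * ((ℓ + 1) * Mh) := le_trans (Nat.succ_le_succ (le_max_right _ _)) hN0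
  -- (2.61) for the cube sequence at the rate `σ = δm/2 − δm/4`
  obtain ⟨h261, -⟩ := rowSum_and_thresholdT (D := cubeFam D q hL hM hMh hP) hMh hP hσ0 0 hN₁ hN1'
  have hrow : ∀ b : ↥(B6Geom246MultiLevelBoxL0.bset (cubeFam D q hL hM hMh hP).toDomains),
      ∑ c : ↥(B6Geom246MultiLevelBoxL0.bset (cubeFam D q hL hM hMh hP).toDomains),
        Real.exp (-((δm / 2 - σ) * (B6Geom246MultiLevelTorusL0.geomT (cubeFam D q hL hM hMh hP)).dist b c)) ≤ K :=
    fun b => h261 (δm / 2 - σ) (by rw [hσ]; linarith) b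
  -- the cube-geometry distance is non-negative
  have hdist := (triangle_refl_nonneg_T (cubeFam D q hL hM hMh hP) hMh hP).2.2
  have hmono : ∀ (Cx δx : ℝ) (n : ℕ), Cx ≤ Cm → δm ≤ δx → 0 ≤ Cx →
      ∀ y y' : (B6Geom246MultiLevelTorusL0.geomT (cubeFam D q hL hM hMh hP)).Site,
        Cx * ((ℓ : ℝ) + 1) ^ n * Real.exp (-(δx / 2 * (B6Geom246MultiLevelTorusL0.geomT (cubeFam D q hL hM hMh hP)).dist y y')) ≤
          Cm * ((ℓ : ℝ) + 1) ^ n * Real.exp (-(δm / 2 * (B6Geom246MultiLevelTorusL0.geomT (cubeFam D q hL hM hMh hP)).dist y y')) := by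
    intro Cx δx n hCx hδx hCx0 y y'
    have hd := hdist y y'
    refine mul_le_mul (mul_le_mul_of_nonneg_right hCx (pow_nonneg hL0 n)) (Real.exp_le_exp.2 ?_) (Real.exp_nonneg _)
      (mul_nonneg hCm0.le (pow_nonneg hL0 n))
    nlinarith
  -- the global transfer of file 1c at exponent `n`, cube rate `δm/2`, member rate `σ`
  have transfer : ∀ {T : Module.End ℝ (↥(boxDom (N0 ℓ Mh k P)) → ℝ)} (n : ℕ),
      HasMajorant (g := B6Geom246MultiLevelTorusL0.geomT (cubeFam D q hL hM hMh hP))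
        (B6Geom246MultiLevelBoxL0.blkOf (cubeFam D q hL hM hMh hP).toDomains) T
        (fun y y' => Cm * ((ℓ : ℝ) + 1) ^ (n * y.1.1) *
          Real.exp (-(δm / 2 * (B6Geom246MultiLevelTorusL0.geomT (cubeFam D q hL hM hMh hP)).dist y y'))) →
      |T lam x| ≤ Cm * (K + 1) * ((ℓ : ℝ) + 1) ^ (n * D.lev x.1) * Real.exp (-(σ * (geomT D).dist (blkOf D.toDomains x) y')) * B := by
    intro T n hT
    have h := majorant_transfer_global (δ := δm / 2) (δ' := σ) hCm0.le hσ0.le hT hrow y' lam B hlam x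
    refine h.trans ?_
    have h0 : 0 ≤ ((ℓ : ℝ) + 1) ^ (n * D.lev x.1) * Real.exp (-(σ * (geomT D).dist (blkOf D.toDomains x) y')) * B :=
      mul_nonneg (mul_nonneg (pow_nonneg hL0 _) (Real.exp_nonneg _)) hlam.nonneg
    have : Cm * K * ((ℓ : ℝ) + 1) ^ (n * D.lev x.1) * Real.exp (-(σ * (geomT D).dist (blkOf D.toDomains x) y')) * B
        = (Cm * K) * (((ℓ : ℝ) + 1) ^ (n * D.lev x.1) * Real.exp (-(σ * (geomT D).dist (blkOf D.toDomains x) y')) * B) := by ring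
    rw [this]
    have : Cm * (K + 1) * ((ℓ : ℝ) + 1) ^ (n * D.lev x.1) * Real.exp (-(σ * (geomT D).dist (blkOf D.toDomains x) y')) * B
        = (Cm * (K + 1)) * (((ℓ : ℝ) + 1) ^ (n * D.lev x.1) * Real.exp (-(σ * (geomT D).dist (blkOf D.toDomains x) y')) * B) := by ring
    rw [this]
    exact mul_le_mul_of_nonneg_right (by nlinarith) h0
  refine ⟨?_, fun μ => ?_, fun μ => ?_, ?_⟩
  · have h := transfer 2 (hasMajorant_mono _ (hA D q hL hM hMh hP h3 hMa' hR hNa' hP4) fun y y' =>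
      hmono Ca δa (2 * y.1.1) ((le_max_left _ _).trans (le_max_left _ _)) ((min_le_left _ _).trans (min_le_left _ _)) hCa.le y y')
    rw [Matrix.toLin'_apply] at h
    exact h
  · have h := transfer 1 (hasMajorant_mono _ (hB D q hL hM hMh hP h3 hMb' hR hNb' hP4 μ) fun y y' => by
      rw [one_mul]
      exact hmono Cb δb y.1.1 ((le_max_right _ _).trans (le_max_left _ _)) ((min_le_left _ _).trans (min_le_right _ _)) hCb.le y y')
    rw [Matrix.toLin'_apply, one_mul] at h
    exact h
  · have h := transfer 1 (hasMajorant_mono _ (hCC D q hL hM hMh hP h3 hMc' hR hNc' hP4 μ) fun y y' => by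
      rw [one_mul]
      exact hmono Cc δc y.1.1 ((le_max_left _ _).trans (le_max_right _ _)) ((min_le_right _ _).trans (min_le_left _ _)) hCc.le y y')
    rw [Matrix.toLin'_apply, one_mul] at h
    exact h
  · have h := transfer 0 (hasMajorant_mono _ (hE D q hL hM hMh hP h3 hMe' hR hNe' hP4) fun y y' => by
      rw [zero_mul, pow_zero, mul_one]
      have := hmono Ce δe 0 ((le_max_right _ _).trans (le_max_right _ _)) ((min_le_right _ _).trans (min_le_right _ _)) hCe.le y y'
      rw [pow_zero, mul_one, mul_one] at this
      exact this)
    rw [Matrix.toLin'_apply, zero_mul, pow_zero, mul_one] at h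
    exact h

end Literature.MathematicalPhysics.QuantumFieldTheory.Balaban1983to89.B9Thm31CubeLocalFlatMemberGlobal
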